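import Literature.MathematicalPhysics.QuantumFieldTheory.Balaban1983to89.Node00.HistoryTermIndexedGenerator
import Summits.QuantumFields.BalabanUV.T4Continuum.Spine.NE1p.DressedOutputAnalyticFaces

/-!
# BalabanUVNodes ∕ N10 ([B13], `Dag.B13_main`, NODE A) → N22 (NE9): THE (2.13)-STOREY OF THE ANALYTIC READING — node N22's generator-level rows
# (AR-fact) `hGA`, (AR-holo) `hA`, (AR-bound) `hMbA` on node00-def-W1's one-step map `(G k).E` FOLLOW from the same three rows ONE LAYER DOWN, on the
# ACTIVITIES `(G k).H t old φ Z`, `Z ⊂ X`, by Kotecký–Preiss holomorphy in a Banach parameter + the (2.41) envelope (module 101)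

Track A of `YM-PLAN.md` (cell `pub-ymgap`, HUMAN RULING D-0062), seat `pub-ymgap-dag-n10-c` g19 (R134 (a), N10 [B13] lane owner), DAG edge **N10 → N22**.
THEOREMS ONLY (0 `def`, 0 `sorry`, standard axioms); `--supports stmt-QuantumFields-27364 --as helper`; COUNT-NEUTRAL.  Answers the INTERFACES register row
**IR-N22-AR** (lit-balaban iface-1 g172, INTERFACES.md §3 l.1175∕1176; requester dag-n22-c g18, module J58
`…Theorems.BalabanUVNodesN22AtRecordOfGenAnalyticReading` §1 ll. ≈175–197): «the ONE producer-facing binder N22's ROAD 2 asks of node N10 ∕ NODE A in the recursion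
currency — the ANALYTIC READING (AR) of def-W1's one-step map in the OLDER TERMS: the verbatim block `hGA hA hMbA hAdmr hρ₁ hρ₂`».  Namespace `YMDAG.N10` as proposed there.

WHAT IS PRODUCED, FOR WHICH GENERATORS.  For EVERY generator tower `G : Node00.W1.GenTower P 𝔸 M` (def-W1 `Node00.HistoryRecursionOfRecord`: the one-step map
`(G k).E t old φ X` IS (2.13) — `B13Resummation.locE` on the torus polymer geometry `tgeometry P.d (domCount P M (k+1))` of the activities
`(G k).H t old φ Z = Σ_{i ∈ (G k).idx Z} (G k).T i t old φ`, DEFINITIONAL), every space table `sp`, admissible class `Adm`, family of complex normed spaces `Pot k` and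
reading `ρ k : OlderTerms → Pot k`: IF the ACTIVITIES of the polymers `Z ⊂ X` are read through `ρ k` — (H-fact) `(G k).H t old φ Z = h k t φ Z (ρ k old)` on `Adm k`,
(H-holo) `h k t φ Z` complex differentiable on `ball 0 R`, (H-38) ONE (2.38)-SHAPE majorant `‖h k t φ Z p‖ ≤ A·e^{−R₃₈ d_{k+1}(Z)}` on that ball ([II] Lemma 3 (2.38) p. 20,
read for the older terms as independent variables) — and the two LOCATED Kotecký–Preiss numerals hold («κ sufficiently large» `r₁ + 2κ₀(4·2^d, 2d) + 2 ≤ R₃₈`,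
«ε₁ sufficiently small» `A·e^{5r₁+1}·K₀(4·2^d, 2d)·(2d+1)·4·2^d ≤ 1`, [II] p. 21), THEN the generator-level rows hold with
  `A k t φ X p := locE … (fun Z ↦ h k t φ Z p) (cubes X)` — (2.13) OF THE READ ACTIVITIES — `M_b := e·(2d+1)·4·2^d·K₀(4·2^d, 2d)²·A`, `κ_E := r₁`:
(AR-fact) by `locE_congr` ((2.13) reads only the activities of the polymers `Z ⊂ X`, [II] p. 15), (AR-holo) + (AR-bound) by the NE1′ crew's kernel face
`Summit.….NE1p.DressedOutputAnalyticFaces.analytic_and_bounded_locE_param_of_geometry` (S25: `B13LocEAnalytic` holomorphy of `locE` in a BANACH parameter under KP,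
[KP86] p. 493, + `B13Resummation.norm_locE_le_of_small`, the (2.39)–(2.41) envelope) AT def-W1's geometry `tgeometry P.d ·` (pv22, all geometry fields PROVED).
* §0 `E_eq_locE_of_activityReading` — def-W1's `(G k).E` against ANY activity assignment agreeing with `(G k).H t old φ` on the polymers `Z ⊂ X`.
* §1 ★ `differentiableOn_and_norm_locE_of_activityReading` — ONE step, ONE domain: read activities holomorphic on the `Pot`-ball under one (2.38)-shape majorant + the two numerals
  ⟹ their (2.13) is holomorphic on the ball and bounded by `M_b·e^{−r₁ d_{k+1}(X)}` there (general dimension `P.d`; constants of `tgeometry_consts`).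
* §2 ★★★ `genAnalyticReading_of_activityReading` — the three rows of module J57 §2's variable block (`hGA`, `hA`, `hMb`) VERBATIM, one torus, from (H-fact)∕(H-holo)∕(H-38);
  `exists_genAnalyticReading_of_activityReading` — the same with `A` bound existentially (the consumer's `obtain ⟨A, hGA, hA, hMbA⟩`).
* §3 `activityReading_of_termReading` — the TERM → ACTIVITY storey (finite sums over `(G k).idx Z`): per-index readings `a k i t φ` of the generic (2.14) terms with
  (T-fact)∕(T-holo) ⟹ (H-fact)∕(H-holo) for `h k t φ Z := Σ_{i ∈ (G k).idx Z} a k i t φ` ((H-38) stays stated on the activity — it IS Lemma 3's statement).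
* §3′ `activityReading_ofTerms`, ★★★ `exists_genAnalyticReading_ofTerms` — at def-W1's TERM-INDEXED generator `GenTower.ofTerms L T` (storey 6, print's labels
  `(𝐃, P) ∈ terms L M Z`): per-label readings with (T-fact)∕(T-holo)∕(T-wt) (the per-term shape of this lane's `B13TermDatum214ParamHolo.h226T_of_inputs226Holo` at
  `W := ball 0 R`) + Lemma 3's term count (Σ-38) `Σ_{s ∈ terms L M Z} wt k Z s ≤ A·e^{−R₃₈ d_{k+1}(Z)}` ([II] (2.35)–(2.38), displayed) ⟹ the activity rows, hence the
  generator-level analytic reading of `(GenTower.ofTerms L T k).E`.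
* §4 ★★★ `exists_genAnalyticReading_of_activityReading_family` — at a `T4Family`'s parameters `F.P K` (d = 4: numerals `64·log 162`, `K₀(64, 8)`, `9`, `64`), K-indexed,
  the rows `hGA ∧ hA ∧ hMbA` of module J58 §1 ∕ §2 ∕ §3 VERBATIM (∃-form), from the K-indexed activity-level rows.
NOT PRODUCED HERE (not node N10's estimates): (AR-adm) `hAdmr` and (AR-dom₁∕₂) `hρ₁ hρ₂` — properties of the READING `ρ` alone (a weighted-sup embedding of the older-term
table; the consumer's ∕ def-W1's choice); and the activity-level rows AT def-T's generator of record — there (H-fact)∕(H-holo) are (2.14)'s holomorphy in the potentials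
(this lane's `B13Term214ParamHolo` ∕ `B13TermDatum214ParamHolo`, per term) composed with (1.41)'s LINEAR reading of the older-term table, typable when def-T pins the generator.

HONEST FRAMING (binding).  Kernel COMPOSITION of tree theorems ([KP86] holomorphy + [II] (2.41), both PROVED in the tree over abstract polymer systems and pv22's constructed
torus geometry) with def-W1's generator BY TYPING (`StepGen.E` is (2.13) by definition); the activity-level rows (H-fact)∕(H-holo)∕(H-38) are DISPLAYED HYPOTHESES (GAPS
G-ne9p2-5 one layer down; inhabited by every generator ignoring `old` with `h` constant in the `Pot`-direction — A5, conditional content); NO estimate of Bałaban's is proved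
or asserted; nothing of the record is constructed.  N10 and N22 are NOT discharged (typed 28∕28 · discharged 5∕27 UNCHANGED); K1⁹ ∕ K3⁸ NOT closed, no stub touched; one
finite 𝕋⁴ programme at fixed ε — NOTHING about the continuum limit, ℝ⁴, OS axioms, a mass gap or the Clay problem is proved or claimed.  References (TYPES only):
[II] = Bałaban, CMP 116 (1988) (2.13)–(2.15) pp. 14–15, Lemma 3 (2.38) p. 20, (2.39)–(2.41) p. 21; [I] = CMP 109 (1987) (2.12)–(2.13) p. 268; [KP86] = Kotecký–Preiss,
CMP 103 (1986) Theorem p. 492, p. 493.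
-/

noncomputable section

open Set Metric
open scoped BigOperators

namespace YMDAG.N10

open Literature.MathematicalPhysics.QuantumFieldTheory.Balaban1983to89
open Literature.MathematicalPhysics.QuantumFieldTheory.Balaban1983to89.T4Continuum (T4Family)
open Literature.MathematicalPhysics.QuantumFieldTheory.Balaban1983to89.B12TreeDecay (K₀ kappa₀)
open Literature.MathematicalPhysics.QuantumFieldTheory.Balaban1983to89.B13Resummation (locE locE_congr)
open Literature.MathematicalPhysics.QuantumFieldTheory.Balaban1983to89.TreeLengthTorusGeometry (tgeometry)
open Literature.MathematicalPhysics.QuantumFieldTheory.Balaban1983to89.Node00.Sect2 (domSys domCount CPair)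
open Literature.MathematicalPhysics.QuantumFieldTheory.Balaban1983to89.B13Lemma3TorusTerms (terms)
open Literature.MathematicalPhysics.QuantumFieldTheory.Balaban1983to89.Node00.W1
open Summit.QuantumFields.BalabanUV.T4Continuum.NE1p.DressedOutputAnalyticFaces (analytic_and_bounded_locE_param_of_geometry)

/-! ## §0 def-W1's one-step map against an activity assignment agreeing on the polymers `Z ⊂ X` -/
section Step

variable {P : Params} {𝔸 : Type*} {M k : ℕ} (Gk : StepGen P 𝔸 M k)

open Classical in
/-- **(2.13) READS ONLY THE ACTIVITIES OF THE POLYMERS `Z ⊂ X`** ([II] p. 15 «Z̃₀ ⊂ Z ⊂ X for the activities in (2.13)»): def-W1's one-step map `(G k).E t old φ X`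
(= `locE` of the activities `(G k).H t old φ`, DEFINITIONAL) equals the (2.13)-sum of ANY activity assignment `w` agreeing with `(G k).H t old φ` on the polymers
`Z ⊂ X` (`B13Resummation.locE_congr`). [folklore] -/
theorem E_eq_locE_of_activityReading {t : ℂ} {old : OlderTerms P 𝔸 M k} {φ : CPair P 𝔸} (X : (domSys P M (k + 1)).Dom)
    {w : (domSys P M (k + 1)).Dom → ℂ} (hw : ∀ Z : (domSys P M (k + 1)).Dom, Subtype.val Z ⊆ Subtype.val X → Gk.H t old φ Z = w Z) :
    Gk.E t old φ X =
      locE (tgeometry P.d (domCount P M (k + 1))).ι (tgeometry P.d (domCount P M (k + 1))).cubes w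
        ((tgeometry P.d (domCount P M (k + 1))).cubes X) :=
  locE_congr _ fun Z hZ => hw Z hZ

/-! ## §1 ★ ONE step, ONE domain: the (2.13) of READ activities is holomorphic on the `Pot`-ball and obeys the (2.41) envelope there -/

open Classical in
/-- ★ **KOTECKÝ–PREISS HOLOMORPHY IN A BANACH PARAMETER + THE (2.41) ENVELOPE, AT def-W1's TORUS GEOMETRY** (the NE1′ kernel face
`analytic_and_bounded_locE_param_of_geometry` at `tgeometry P.d (domCount P M (k+1))`, constants by `tgeometry_consts`).  Read activities `h Z : Pot → ℂ` of the polymers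
`Z ⊂ X`, complex differentiable on `ball 0 R` and dominated there by ONE (2.38)-shape majorant `A·e^{−R₃₈ d_{k+1}(Z)}`, with «κ sufficiently large»
`r₁ + 2κ₀(4·2^d, 2d) + 2 ≤ R₃₈` and «ε₁ sufficiently small» `A·e^{5r₁+1}·K₀(4·2^d, 2d)·(2d+1)·4·2^d ≤ 1` ⟹ `p ↦ locE … (fun Z ↦ h Z p) (cubes X)` is complex differentiable
on `ball 0 R` and bounded there by `e·(2d+1)·4·2^d·K₀(4·2^d, 2d)²·A·e^{−r₁ d_{k+1}(X)}`. [folklore] -/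
theorem differentiableOn_and_norm_locE_of_activityReading {Pot : Type*} [NormedAddCommGroup Pot] [NormedSpace ℂ Pot] (X : (domSys P M (k + 1)).Dom)
    {h : (domSys P M (k + 1)).Dom → Pot → ℂ} {A R₃₈ r₁ R : ℝ} (hA : 0 ≤ A) (hr₁ : 0 ≤ r₁)
    (hrate : r₁ + 2 * kappa₀ (4 * 2 ^ P.d) (2 * P.d) + 2 ≤ R₃₈)
    (hsmall : A * Real.exp (5 * r₁ + 1) * K₀ (4 * 2 ^ P.d) (2 * P.d) * (2 * (P.d : ℝ) + 1) * (4 * 2 ^ P.d) ≤ 1)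
    (hhol : ∀ Z : (domSys P M (k + 1)).Dom, Subtype.val Z ⊆ Subtype.val X → DifferentiableOn ℂ (h Z) (ball 0 R))
    (h38 : ∀ Z : (domSys P M (k + 1)).Dom, Subtype.val Z ⊆ Subtype.val X → ∀ p ∈ ball (0 : Pot) R,
      ‖h Z p‖ ≤ A * Real.exp (-(R₃₈ * (domSys P M (k + 1)).dj Z))) :
    DifferentiableOn ℂ (fun p => locE (tgeometry P.d (domCount P M (k + 1))).ι (tgeometry P.d (domCount P M (k + 1))).cubes (fun Z => h Z p)
        ((tgeometry P.d (domCount P M (k + 1))).cubes X)) (ball 0 R) ∧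
      ∀ p ∈ ball (0 : Pot) R, ‖locE (tgeometry P.d (domCount P M (k + 1))).ι (tgeometry P.d (domCount P M (k + 1))).cubes (fun Z => h Z p)
          ((tgeometry P.d (domCount P M (k + 1))).cubes X)‖ ≤
        Real.exp 1 * (2 * (P.d : ℝ) + 1) * (4 * 2 ^ P.d) * K₀ (4 * 2 ^ P.d) (2 * P.d) ^ 2 * A * Real.exp (-(r₁ * (domSys P M (k + 1)).dj X)) :=
  analytic_and_bounded_locE_param_of_geometry (tgeometry P.d (domCount P M (k + 1)))
    (m := fun Z => A * Real.exp (-(R₃₈ * (domSys P M (k + 1)).dj Z))) (act := fun p Z => h Z p) (A := A) (R := R₃₈) (r₁ := r₁) X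
    isOpen_ball hA hr₁ hrate hsmall hhol (fun p hp Z hZ => h38 Z hZ p hp) (fun _ _ => le_rfl)

end Step

/-! ## §2 ★★★ The generator-level ANALYTIC READING from the activity-level one (module J57 §2's rows `hGA`, `hA`, `hMb` VERBATIM, one torus) -/
section Gen

variable {P : Params} {𝔸 : Type} {M : ℕ} (G : GenTower P 𝔸 M) (sp : (k : ℕ) → (domSys P M (k + 1)).Dom → Set (CPair P 𝔸))
  (Adm : (k : ℕ) → OlderTerms P 𝔸 M k → Prop)
  {Pot : ℕ → Type*} [∀ k, NormedAddCommGroup (Pot k)] [∀ k, NormedSpace ℂ (Pot k)]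
  (ρ : (k : ℕ) → OlderTerms P 𝔸 M k → Pot k) (h : (k : ℕ) → ℝ → CPair P 𝔸 → (domSys P M (k + 1)).Dom → Pot k → ℂ)

open Classical in
/-- ★★★ **THE GENERATOR-LEVEL ANALYTIC READING FROM THE ACTIVITY-LEVEL ONE.**  For a generator tower `G`, a space table `sp`, an admissible class `Adm`, normed
spaces `Pot k`, a reading `ρ k` of the older terms and an ACTIVITY READING `h k t φ Z : Pot k → ℂ`: (H-fact) on `Adm k` the activities of the polymers `Z ⊂ X` factor
`(G k).H t old φ Z = h k t φ Z (ρ k old)`; (H-holo) `h k t φ Z` complex differentiable on `ball 0 R`; (H-38) `‖h k t φ Z p‖ ≤ A·e^{−R₃₈ d_{k+1}(Z)}` on that ball; the two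
located numerals ⟹ module J57's THREE rows with **`A k t φ X p := locE … (fun Z ↦ h k t φ Z p) (cubes X)`**, **`M_b := e·(2d+1)·4·2^d·K₀(4·2^d, 2d)²·A`**, **`κ := r₁`**:
(AR-fact) `(G k).E t old φ X = A k t φ X (ρ k old)` (§0), (AR-holo) `DifferentiableOn ℂ (A k t φ X) (ball 0 R)` and (AR-bound) `‖A k t φ X p‖ ≤ M_b·e^{−κ d_{k+1}(X)}` (§1).
[folklore] -/
theorem genAnalyticReading_of_activityReading {γ A R₃₈ r₁ R : ℝ} (hA : 0 ≤ A) (hr₁ : 0 ≤ r₁)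
    (hrate : r₁ + 2 * kappa₀ (4 * 2 ^ P.d) (2 * P.d) + 2 ≤ R₃₈)
    (hsmall : A * Real.exp (5 * r₁ + 1) * K₀ (4 * 2 ^ P.d) (2 * P.d) * (2 * (P.d : ℝ) + 1) * (4 * 2 ^ P.d) ≤ 1)
    (hHA : ∀ (k : ℕ), ∀ t ∈ Ioc (0 : ℝ) γ, ∀ (old : OlderTerms P 𝔸 M k), Adm k old → ∀ (X : (domSys P M (k + 1)).Dom), ∀ φ ∈ sp k X,
      ∀ Z : (domSys P M (k + 1)).Dom, Subtype.val Z ⊆ Subtype.val X → (G k).H ((t : ℝ) : ℂ) old φ Z = h k t φ Z (ρ k old))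
    (hHh : ∀ (k : ℕ), ∀ t ∈ Ioc (0 : ℝ) γ, ∀ (X : (domSys P M (k + 1)).Dom), ∀ φ ∈ sp k X,
      ∀ Z : (domSys P M (k + 1)).Dom, Subtype.val Z ⊆ Subtype.val X → DifferentiableOn ℂ (h k t φ Z) (ball 0 R))
    (hH38 : ∀ (k : ℕ), ∀ t ∈ Ioc (0 : ℝ) γ, ∀ (X : (domSys P M (k + 1)).Dom), ∀ φ ∈ sp k X,
      ∀ Z : (domSys P M (k + 1)).Dom, Subtype.val Z ⊆ Subtype.val X → ∀ p ∈ ball (0 : Pot k) R,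
        ‖h k t φ Z p‖ ≤ A * Real.exp (-(R₃₈ * (domSys P M (k + 1)).dj Z))) :
    (∀ (k : ℕ), ∀ t ∈ Ioc (0 : ℝ) γ, ∀ (old : OlderTerms P 𝔸 M k), Adm k old → ∀ (X : (domSys P M (k + 1)).Dom), ∀ φ ∈ sp k X,
      (G k).E ((t : ℝ) : ℂ) old φ X =
        (fun p => locE (tgeometry P.d (domCount P M (k + 1))).ι (tgeometry P.d (domCount P M (k + 1))).cubes (fun Z => h k t φ Z p)
          ((tgeometry P.d (domCount P M (k + 1))).cubes X)) (ρ k old)) ∧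
    (∀ (k : ℕ), ∀ t ∈ Ioc (0 : ℝ) γ, ∀ (X : (domSys P M (k + 1)).Dom), ∀ φ ∈ sp k X,
      DifferentiableOn ℂ (fun p => locE (tgeometry P.d (domCount P M (k + 1))).ι (tgeometry P.d (domCount P M (k + 1))).cubes (fun Z => h k t φ Z p)
        ((tgeometry P.d (domCount P M (k + 1))).cubes X)) (ball 0 R)) ∧
    (∀ (k : ℕ), ∀ t ∈ Ioc (0 : ℝ) γ, ∀ (X : (domSys P M (k + 1)).Dom), ∀ φ ∈ sp k X, ∀ p ∈ ball (0 : Pot k) R,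
      ‖(fun p => locE (tgeometry P.d (domCount P M (k + 1))).ι (tgeometry P.d (domCount P M (k + 1))).cubes (fun Z => h k t φ Z p)
          ((tgeometry P.d (domCount P M (k + 1))).cubes X)) p‖ ≤
        Real.exp 1 * (2 * (P.d : ℝ) + 1) * (4 * 2 ^ P.d) * K₀ (4 * 2 ^ P.d) (2 * P.d) ^ 2 * A *
          Real.exp (-(r₁ * (domSys P M (k + 1)).dj X))) := by
  refine ⟨fun k t ht old hold X φ hφ => ?_, fun k t ht X φ hφ => ?_, fun k t ht X φ hφ p hp => ?_⟩
  · exact E_eq_locE_of_activityReading (G k) X fun Z hZ => hHA k t ht old hold X φ hφ Z hZ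
  · exact (differentiableOn_and_norm_locE_of_activityReading (k := k) X hA hr₁ hrate hsmall (hHh k t ht X φ hφ) (hH38 k t ht X φ hφ)).1
  · exact (differentiableOn_and_norm_locE_of_activityReading (k := k) X hA hr₁ hrate hsmall (hHh k t ht X φ hφ) (hH38 k t ht X φ hφ)).2 p hp

open Classical in
/-- ★★★ **THE SAME, `A` BOUND EXISTENTIALLY** — the consumer's `obtain ⟨A, hGA, hA, hMbA⟩ := …` for module J57 §2 ∕ module J58 (one torus): an analytic reading
`A k t φ X : Pot k → ℂ` with (AR-fact), (AR-holo) on `ball 0 R`, (AR-bound) `M_b = e·(2d+1)·4·2^d·K₀(4·2^d, 2d)²·A`, `κ = r₁` EXISTS as soon as the activity-level rows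
(H-fact)∕(H-holo)∕(H-38) and the two located numerals hold. [folklore] -/
theorem exists_genAnalyticReading_of_activityReading {γ A R₃₈ r₁ R : ℝ} (hA : 0 ≤ A) (hr₁ : 0 ≤ r₁)
    (hrate : r₁ + 2 * kappa₀ (4 * 2 ^ P.d) (2 * P.d) + 2 ≤ R₃₈)
    (hsmall : A * Real.exp (5 * r₁ + 1) * K₀ (4 * 2 ^ P.d) (2 * P.d) * (2 * (P.d : ℝ) + 1) * (4 * 2 ^ P.d) ≤ 1)
    (hHA : ∀ (k : ℕ), ∀ t ∈ Ioc (0 : ℝ) γ, ∀ (old : OlderTerms P 𝔸 M k), Adm k old → ∀ (X : (domSys P M (k + 1)).Dom), ∀ φ ∈ sp k X,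
      ∀ Z : (domSys P M (k + 1)).Dom, Subtype.val Z ⊆ Subtype.val X → (G k).H ((t : ℝ) : ℂ) old φ Z = h k t φ Z (ρ k old))
    (hHh : ∀ (k : ℕ), ∀ t ∈ Ioc (0 : ℝ) γ, ∀ (X : (domSys P M (k + 1)).Dom), ∀ φ ∈ sp k X,
      ∀ Z : (domSys P M (k + 1)).Dom, Subtype.val Z ⊆ Subtype.val X → DifferentiableOn ℂ (h k t φ Z) (ball 0 R))
    (hH38 : ∀ (k : ℕ), ∀ t ∈ Ioc (0 : ℝ) γ, ∀ (X : (domSys P M (k + 1)).Dom), ∀ φ ∈ sp k X,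
      ∀ Z : (domSys P M (k + 1)).Dom, Subtype.val Z ⊆ Subtype.val X → ∀ p ∈ ball (0 : Pot k) R,
        ‖h k t φ Z p‖ ≤ A * Real.exp (-(R₃₈ * (domSys P M (k + 1)).dj Z))) :
    ∃ A' : (k : ℕ) → ℝ → CPair P 𝔸 → (domSys P M (k + 1)).Dom → Pot k → ℂ,
      (∀ (k : ℕ), ∀ t ∈ Ioc (0 : ℝ) γ, ∀ (old : OlderTerms P 𝔸 M k), Adm k old → ∀ (X : (domSys P M (k + 1)).Dom), ∀ φ ∈ sp k X,
        (G k).E ((t : ℝ) : ℂ) old φ X = A' k t φ X (ρ k old)) ∧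
      (∀ (k : ℕ), ∀ t ∈ Ioc (0 : ℝ) γ, ∀ (X : (domSys P M (k + 1)).Dom), ∀ φ ∈ sp k X, DifferentiableOn ℂ (A' k t φ X) (ball 0 R)) ∧
      (∀ (k : ℕ), ∀ t ∈ Ioc (0 : ℝ) γ, ∀ (X : (domSys P M (k + 1)).Dom), ∀ φ ∈ sp k X, ∀ p ∈ ball (0 : Pot k) R,
        ‖A' k t φ X p‖ ≤ Real.exp 1 * (2 * (P.d : ℝ) + 1) * (4 * 2 ^ P.d) * K₀ (4 * 2 ^ P.d) (2 * P.d) ^ 2 * A *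
          Real.exp (-(r₁ * (domSys P M (k + 1)).dj X))) := by
  obtain ⟨h1, h2, h3⟩ := genAnalyticReading_of_activityReading G sp Adm ρ h hA hr₁ hrate hsmall hHA hHh hH38
  exact ⟨fun k t φ X p => locE (tgeometry P.d (domCount P M (k + 1))).ι (tgeometry P.d (domCount P M (k + 1))).cubes (fun Z => h k t φ Z p)
    ((tgeometry P.d (domCount P M (k + 1))).cubes X), h1, h2, h3⟩

/-! ## §3 The TERM → ACTIVITY storey: finite sums over the indices `(G k).idx Z` localizing at `Z` -/

/-- **PER-INDEX READINGS OF THE GENERIC (2.14) TERMS GIVE THE ACTIVITY READING** ((2.11): `H(Z) = Σ_{i ∈ idx Z} T i`, def-W1's `StepGen.H`).  If on `Adm k` every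
generic term localizing at a polymer `Z ⊂ X` factors through the reading — (T-fact) `(G k).T i t old φ = a k i t φ (ρ k old)` for `i ∈ (G k).idx Z` — and (T-holo) each
`a k i t φ` is complex differentiable on `ball 0 R`, then (H-fact) and (H-holo) hold for the activity reading **`h k t φ Z := Σ_{i ∈ (G k).idx Z} a k i t φ`**
(`Finset.sum_congr`, `DifferentiableOn.fun_sum`).  The (2.38)-shape majorant (H-38) stays stated on the activity — it IS [II] Lemma 3's statement. [folklore] -/
theorem activityReading_of_termReading (a : (k : ℕ) → (G k).Idx → ℝ → CPair P 𝔸 → Pot k → ℂ) {γ R : ℝ}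
    (hTa : ∀ (k : ℕ), ∀ t ∈ Ioc (0 : ℝ) γ, ∀ (old : OlderTerms P 𝔸 M k), Adm k old → ∀ (X : (domSys P M (k + 1)).Dom), ∀ φ ∈ sp k X,
      ∀ Z : (domSys P M (k + 1)).Dom, Subtype.val Z ⊆ Subtype.val X → ∀ i ∈ (G k).idx Z, (G k).T i ((t : ℝ) : ℂ) old φ = a k i t φ (ρ k old))
    (hTh : ∀ (k : ℕ), ∀ t ∈ Ioc (0 : ℝ) γ, ∀ (X : (domSys P M (k + 1)).Dom), ∀ φ ∈ sp k X,
      ∀ Z : (domSys P M (k + 1)).Dom, Subtype.val Z ⊆ Subtype.val X → ∀ i ∈ (G k).idx Z, DifferentiableOn ℂ (a k i t φ) (ball 0 R)) :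
    (∀ (k : ℕ), ∀ t ∈ Ioc (0 : ℝ) γ, ∀ (old : OlderTerms P 𝔸 M k), Adm k old → ∀ (X : (domSys P M (k + 1)).Dom), ∀ φ ∈ sp k X,
      ∀ Z : (domSys P M (k + 1)).Dom, Subtype.val Z ⊆ Subtype.val X →
        (G k).H ((t : ℝ) : ℂ) old φ Z = (fun k t φ (Z : (domSys P M (k + 1)).Dom) (p : Pot k) => ∑ i ∈ (G k).idx Z, a k i t φ p) k t φ Z (ρ k old)) ∧
    (∀ (k : ℕ), ∀ t ∈ Ioc (0 : ℝ) γ, ∀ (X : (domSys P M (k + 1)).Dom), ∀ φ ∈ sp k X,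
      ∀ Z : (domSys P M (k + 1)).Dom, Subtype.val Z ⊆ Subtype.val X →
        DifferentiableOn ℂ ((fun k t φ (Z : (domSys P M (k + 1)).Dom) (p : Pot k) => ∑ i ∈ (G k).idx Z, a k i t φ p) k t φ Z) (ball 0 R)) := by
  refine ⟨fun k t ht old hold X φ hφ Z hZ => ?_, fun k t ht X φ hφ Z hZ => ?_⟩
  · exact Finset.sum_congr rfl fun i hi => hTa k t ht old hold X φ hφ Z hZ i hi
  · exact DifferentiableOn.fun_sum fun i hi => hTh k t ht X φ hφ Z hZ i hi

end Gen

/-! ## §3′ At def-W1's TERM-INDEXED generator `GenTower.ofTerms L T` (print's labels `(𝐃, P) ∈ terms L M Z`, storey 6 `HistoryTermIndexedGenerator`) -/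
section OfTerms

variable {P : Params} {𝔸 : Type} {M : ℕ} [NeZero M] (L : ℕ) [NeZero L] (T : GenTermFun P 𝔸 M L)
  (sp : (k : ℕ) → (domSys P M (k + 1)).Dom → Set (CPair P 𝔸)) (Adm : (k : ℕ) → OlderTerms P 𝔸 M k → Prop)
  {Pot : ℕ → Type*} [∀ k, NormedAddCommGroup (Pot k)] [∀ k, NormedSpace ℂ (Pot k)]
  (ρ : (k : ℕ) → OlderTerms P 𝔸 M k → Pot k)
  (a : (k : ℕ) → (domSys P M (k + 1)).Dom → TermLabel P M k L → ℝ → CPair P 𝔸 → Pot k → ℂ)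
  (wt : (k : ℕ) → (domSys P M (k + 1)).Dom → TermLabel P M k L → ℝ)

/-- **THE ACTIVITY-LEVEL ROWS AT THE TERM-INDEXED GENERATOR FROM PER-TERM READINGS AND PER-TERM WEIGHTS.**  For a term-functional family `T` (def-W1
storey 6: `(GenTower.ofTerms L T k).H t old φ Z = Σ_{s ∈ terms L M Z} T k Z s t old φ`, `ofTerms_H`) and per-label readings `a k Z s t φ : Pot k → ℂ` of the (2.14)
terms: (T-fact) `T k Z s t old φ = a k Z s t φ (ρ k old)` on `Adm k` for the labels `s ∈ terms L M Z` of the polymers `Z ⊂ X`; (T-holo) each `a k Z s t φ` complex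
differentiable on `ball 0 R`; (T-wt) `‖a k Z s t φ p‖ ≤ wt k Z s` on that ball (the (2.26) weight of the term, e.g. this lane's `B13TermDatum214ParamHolo.h226T_of_inputs226Holo`
with `W := ball 0 R`); (Σ-38) `Σ_{s ∈ terms L M Z} wt k Z s ≤ A·e^{−R₃₈ d_{k+1}(Z)}` ([II] (2.35)–(2.38): Lemma 3's term count, displayed) ⟹ the three ACTIVITY-LEVEL rows
(H-fact)∕(H-holo)∕(H-38) of §2 for `G := GenTower.ofTerms L T` and **`h k t φ Z := Σ_{s ∈ terms L M Z} a k Z s t φ`**. [folklore] -/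
theorem activityReading_ofTerms {γ R A R₃₈ : ℝ}
    (hTa : ∀ (k : ℕ), ∀ t ∈ Ioc (0 : ℝ) γ, ∀ (old : OlderTerms P 𝔸 M k), Adm k old → ∀ (X : (domSys P M (k + 1)).Dom), ∀ φ ∈ sp k X,
      ∀ Z : (domSys P M (k + 1)).Dom, Subtype.val Z ⊆ Subtype.val X → ∀ s ∈ terms L M Z, T k Z s ((t : ℝ) : ℂ) old φ = a k Z s t φ (ρ k old))
    (hTh : ∀ (k : ℕ), ∀ t ∈ Ioc (0 : ℝ) γ, ∀ (X : (domSys P M (k + 1)).Dom), ∀ φ ∈ sp k X,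
      ∀ Z : (domSys P M (k + 1)).Dom, Subtype.val Z ⊆ Subtype.val X → ∀ s ∈ terms L M Z, DifferentiableOn ℂ (a k Z s t φ) (ball 0 R))
    (hTw : ∀ (k : ℕ), ∀ t ∈ Ioc (0 : ℝ) γ, ∀ (X : (domSys P M (k + 1)).Dom), ∀ φ ∈ sp k X,
      ∀ Z : (domSys P M (k + 1)).Dom, Subtype.val Z ⊆ Subtype.val X → ∀ s ∈ terms L M Z, ∀ p ∈ ball (0 : Pot k) R, ‖a k Z s t φ p‖ ≤ wt k Z s)
    (hsum : ∀ (k : ℕ) (Z : (domSys P M (k + 1)).Dom), ∑ s ∈ terms L M Z, wt k Z s ≤ A * Real.exp (-(R₃₈ * (domSys P M (k + 1)).dj Z))) :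
    (∀ (k : ℕ), ∀ t ∈ Ioc (0 : ℝ) γ, ∀ (old : OlderTerms P 𝔸 M k), Adm k old → ∀ (X : (domSys P M (k + 1)).Dom), ∀ φ ∈ sp k X,
      ∀ Z : (domSys P M (k + 1)).Dom, Subtype.val Z ⊆ Subtype.val X →
        (GenTower.ofTerms L T k).H ((t : ℝ) : ℂ) old φ Z =
          (fun k t φ (Z : (domSys P M (k + 1)).Dom) (p : Pot k) => ∑ s ∈ terms L M Z, a k Z s t φ p) k t φ Z (ρ k old)) ∧
    (∀ (k : ℕ), ∀ t ∈ Ioc (0 : ℝ) γ, ∀ (X : (domSys P M (k + 1)).Dom), ∀ φ ∈ sp k X,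
      ∀ Z : (domSys P M (k + 1)).Dom, Subtype.val Z ⊆ Subtype.val X →
        DifferentiableOn ℂ ((fun k t φ (Z : (domSys P M (k + 1)).Dom) (p : Pot k) => ∑ s ∈ terms L M Z, a k Z s t φ p) k t φ Z) (ball 0 R)) ∧
    (∀ (k : ℕ), ∀ t ∈ Ioc (0 : ℝ) γ, ∀ (X : (domSys P M (k + 1)).Dom), ∀ φ ∈ sp k X,
      ∀ Z : (domSys P M (k + 1)).Dom, Subtype.val Z ⊆ Subtype.val X → ∀ p ∈ ball (0 : Pot k) R,
        ‖(fun k t φ (Z : (domSys P M (k + 1)).Dom) (p : Pot k) => ∑ s ∈ terms L M Z, a k Z s t φ p) k t φ Z p‖ ≤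
          A * Real.exp (-(R₃₈ * (domSys P M (k + 1)).dj Z))) := by
  refine ⟨fun k t ht old hold X φ hφ Z hZ => ?_, fun k t ht X φ hφ Z hZ => ?_, fun k t ht X φ hφ Z hZ p hp => ?_⟩
  · rw [GenTower.ofTerms_apply, ofTerms_H]
    exact Finset.sum_congr rfl fun s hs => hTa k t ht old hold X φ hφ Z hZ s hs
  · exact DifferentiableOn.fun_sum fun s hs => hTh k t ht X φ hφ Z hZ s hs
  · show ‖∑ s ∈ terms L M Z, a k Z s t φ p‖ ≤ _
    exact (norm_sum_le _ _).trans ((Finset.sum_le_sum fun s hs => hTw k t ht X φ hφ Z hZ s hs p hp).trans (hsum k Z))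

open Classical in
/-- ★★★ **THE GENERATOR-LEVEL ANALYTIC READING OF THE TERM-INDEXED GENERATOR FROM PER-TERM READINGS** — §3′ then §2: per-label readings with
(T-fact)∕(T-holo)∕(T-wt), Lemma 3's term count (Σ-38) and the two located numerals ⟹ an analytic reading `A' k t φ X : Pot k → ℂ` of
`(GenTower.ofTerms L T k).E` with (AR-fact), (AR-holo) on `ball 0 R`, (AR-bound) `M_b = e·(2d+1)·4·2^d·K₀(4·2^d, 2d)²·A`, `κ = r₁`. [folklore] -/
theorem exists_genAnalyticReading_ofTerms {γ R A R₃₈ r₁ : ℝ} (hA : 0 ≤ A) (hr₁ : 0 ≤ r₁)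
    (hrate : r₁ + 2 * kappa₀ (4 * 2 ^ P.d) (2 * P.d) + 2 ≤ R₃₈)
    (hsmall : A * Real.exp (5 * r₁ + 1) * K₀ (4 * 2 ^ P.d) (2 * P.d) * (2 * (P.d : ℝ) + 1) * (4 * 2 ^ P.d) ≤ 1)
    (hTa : ∀ (k : ℕ), ∀ t ∈ Ioc (0 : ℝ) γ, ∀ (old : OlderTerms P 𝔸 M k), Adm k old → ∀ (X : (domSys P M (k + 1)).Dom), ∀ φ ∈ sp k X,
      ∀ Z : (domSys P M (k + 1)).Dom, Subtype.val Z ⊆ Subtype.val X → ∀ s ∈ terms L M Z, T k Z s ((t : ℝ) : ℂ) old φ = a k Z s t φ (ρ k old))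
    (hTh : ∀ (k : ℕ), ∀ t ∈ Ioc (0 : ℝ) γ, ∀ (X : (domSys P M (k + 1)).Dom), ∀ φ ∈ sp k X,
      ∀ Z : (domSys P M (k + 1)).Dom, Subtype.val Z ⊆ Subtype.val X → ∀ s ∈ terms L M Z, DifferentiableOn ℂ (a k Z s t φ) (ball 0 R))
    (hTw : ∀ (k : ℕ), ∀ t ∈ Ioc (0 : ℝ) γ, ∀ (X : (domSys P M (k + 1)).Dom), ∀ φ ∈ sp k X,
      ∀ Z : (domSys P M (k + 1)).Dom, Subtype.val Z ⊆ Subtype.val X → ∀ s ∈ terms L M Z, ∀ p ∈ ball (0 : Pot k) R, ‖a k Z s t φ p‖ ≤ wt k Z s)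
    (hsum : ∀ (k : ℕ) (Z : (domSys P M (k + 1)).Dom), ∑ s ∈ terms L M Z, wt k Z s ≤ A * Real.exp (-(R₃₈ * (domSys P M (k + 1)).dj Z))) :
    ∃ A' : (k : ℕ) → ℝ → CPair P 𝔸 → (domSys P M (k + 1)).Dom → Pot k → ℂ,
      (∀ (k : ℕ), ∀ t ∈ Ioc (0 : ℝ) γ, ∀ (old : OlderTerms P 𝔸 M k), Adm k old → ∀ (X : (domSys P M (k + 1)).Dom), ∀ φ ∈ sp k X,
        (GenTower.ofTerms L T k).E ((t : ℝ) : ℂ) old φ X = A' k t φ X (ρ k old)) ∧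
      (∀ (k : ℕ), ∀ t ∈ Ioc (0 : ℝ) γ, ∀ (X : (domSys P M (k + 1)).Dom), ∀ φ ∈ sp k X, DifferentiableOn ℂ (A' k t φ X) (ball 0 R)) ∧
      (∀ (k : ℕ), ∀ t ∈ Ioc (0 : ℝ) γ, ∀ (X : (domSys P M (k + 1)).Dom), ∀ φ ∈ sp k X, ∀ p ∈ ball (0 : Pot k) R,
        ‖A' k t φ X p‖ ≤ Real.exp 1 * (2 * (P.d : ℝ) + 1) * (4 * 2 ^ P.d) * K₀ (4 * 2 ^ P.d) (2 * P.d) ^ 2 * A *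
          Real.exp (-(r₁ * (domSys P M (k + 1)).dj X))) := by
  obtain ⟨h1, h2, h3⟩ := activityReading_ofTerms L T sp Adm ρ a wt hTa hTh hTw hsum
  exact exists_genAnalyticReading_of_activityReading (GenTower.ofTerms L T) sp Adm ρ
    (fun k t φ Z p => ∑ s ∈ terms L M Z, a k Z s t φ p) hA hr₁ hrate hsmall h1 h2 h3

end OfTerms

/-! ## §4 ★★★ At a `T4Family`'s parameters (d = 4), K-indexed: module J58 §1's rows `hGA ∧ hA ∧ hMbA` VERBATIM (∃-form) -/
section Family

variable (F : T4Family) {𝔸 : Type} {M : ℕ} (Gn : (K : ℕ) → GenTower (F.P K) 𝔸 M)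
  (sp : (K k : ℕ) → (domSys (F.P K) M (k + 1)).Dom → Set (CPair (F.P K) 𝔸))
  (Adm : (K k : ℕ) → OlderTerms (F.P K) 𝔸 M k → Prop)
  {Pot : ℕ → ℕ → Type*} [∀ K k, NormedAddCommGroup (Pot K k)] [∀ K k, NormedSpace ℂ (Pot K k)]
  (ρA : (K k : ℕ) → OlderTerms (F.P K) 𝔸 M k → Pot K k)
  (h : (K k : ℕ) → ℝ → CPair (F.P K) 𝔸 → (domSys (F.P K) M (k + 1)).Dom → Pot K k → ℂ)

open Classical in
/-- ★★★ **MODULE J58's ANALYTIC-READING ROWS `hGA`, `hA`, `hMbA` FROM THE ACTIVITY-LEVEL ROWS, AT A `T4Family` (d = 4), EVERY TORUS `K` AND STEP `k`.**  IF the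
activities of the generator towers `Gn K` are read through `ρA K k` on `Adm K k` for the polymers `Z ⊂ X` — (H-fact) `((Gn K) k).H t old φ Z = h K k t φ Z (ρA K k old)`,
(H-holo) `h K k t φ Z` complex differentiable on `ball 0 R`, (H-38) `‖h K k t φ Z p‖ ≤ A·e^{−R₃₈ d_{k+1}(Z)}` there — and the located numerals
`r₁ + 2·(64·log 162) + 2 ≤ R₃₈`, `A·e^{5r₁+1}·K₀(64, 8)·9·64 ≤ 1` hold, THEN there is `A' K k t φ X : Pot K k → ℂ` with module J58's
(AR-fact) `((Gn K) k).E t old φ X = A' K k t φ X (ρA K k old)`, (AR-holo) `DifferentiableOn ℂ (A' K k t φ X) (ball 0 R)` and (AR-bound)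
`‖A' K k t φ X p‖ ≤ M_b·e^{−κ_E d_{k+1}(X)}` at **`M_b = e·9·64·K₀(64, 8)²·A`**, **`κ_E = r₁`** — §2 at `P := F.P K` (`(F.P K).d = 4`, `TreeLengthCubeSystem.kappa₀_four`).
[folklore] -/
theorem exists_genAnalyticReading_of_activityReading_family {γ A R₃₈ r₁ R : ℝ} (hA : 0 ≤ A) (hr₁ : 0 ≤ r₁)
    (hrate : r₁ + 2 * (64 * Real.log 162) + 2 ≤ R₃₈) (hsmall : A * Real.exp (5 * r₁ + 1) * K₀ 64 8 * 9 * 64 ≤ 1)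
    (hHA : ∀ (K k : ℕ), ∀ t ∈ Ioc (0 : ℝ) γ, ∀ (old : OlderTerms (F.P K) 𝔸 M k), Adm K k old → ∀ (X : (domSys (F.P K) M (k + 1)).Dom), ∀ φ ∈ sp K k X,
      ∀ Z : (domSys (F.P K) M (k + 1)).Dom, Subtype.val Z ⊆ Subtype.val X → ((Gn K) k).H ((t : ℝ) : ℂ) old φ Z = h K k t φ Z (ρA K k old))
    (hHh : ∀ (K k : ℕ), ∀ t ∈ Ioc (0 : ℝ) γ, ∀ (X : (domSys (F.P K) M (k + 1)).Dom), ∀ φ ∈ sp K k X,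
      ∀ Z : (domSys (F.P K) M (k + 1)).Dom, Subtype.val Z ⊆ Subtype.val X → DifferentiableOn ℂ (h K k t φ Z) (ball 0 R))
    (hH38 : ∀ (K k : ℕ), ∀ t ∈ Ioc (0 : ℝ) γ, ∀ (X : (domSys (F.P K) M (k + 1)).Dom), ∀ φ ∈ sp K k X,
      ∀ Z : (domSys (F.P K) M (k + 1)).Dom, Subtype.val Z ⊆ Subtype.val X → ∀ p ∈ ball (0 : Pot K k) R,
        ‖h K k t φ Z p‖ ≤ A * Real.exp (-(R₃₈ * (domSys (F.P K) M (k + 1)).dj Z))) :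
    ∃ A' : (K k : ℕ) → ℝ → CPair (F.P K) 𝔸 → (domSys (F.P K) M (k + 1)).Dom → Pot K k → ℂ,
      (∀ (K k : ℕ), ∀ t ∈ Ioc (0 : ℝ) γ, ∀ (old : OlderTerms (F.P K) 𝔸 M k), Adm K k old → ∀ (X : (domSys (F.P K) M (k + 1)).Dom), ∀ φ ∈ sp K k X,
        ((Gn K) k).E ((t : ℝ) : ℂ) old φ X = A' K k t φ X (ρA K k old)) ∧
      (∀ (K k : ℕ), ∀ t ∈ Ioc (0 : ℝ) γ, ∀ (X : (domSys (F.P K) M (k + 1)).Dom), ∀ φ ∈ sp K k X, DifferentiableOn ℂ (A' K k t φ X) (ball 0 R)) ∧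
      (∀ (K k : ℕ), ∀ t ∈ Ioc (0 : ℝ) γ, ∀ (X : (domSys (F.P K) M (k + 1)).Dom), ∀ φ ∈ sp K k X, ∀ p ∈ ball (0 : Pot K k) R,
        ‖A' K k t φ X p‖ ≤ Real.exp 1 * 9 * 64 * K₀ 64 8 ^ 2 * A * Real.exp (-(r₁ * (domSys (F.P K) M (k + 1)).dj X))) := by
  -- the numerals of `tgeometry 4 ·`: `κ₀(64, 8) = 64·log 162`, `2·4 + 1 = 9`, `4·2⁴ = 64` (`(F.P K).d = 4` definitionally)
  have hκ : kappa₀ (4 * 2 ^ 4) (2 * 4) = 64 * Real.log 162 := TreeLengthCubeSystem.kappa₀_four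
  have e64 : (4 : ℝ) * 2 ^ 4 = 64 := by norm_num
  have e9 : (2 : ℝ) * ((4 : ℕ) : ℝ) + 1 = 9 := by norm_num
  have hrate' : ∀ K : ℕ, r₁ + 2 * kappa₀ (4 * 2 ^ (F.P K).d) (2 * (F.P K).d) + 2 ≤ R₃₈ := fun K => by
    rw [F.P_d K, hκ]; exact hrate
  have hsmall' : ∀ K : ℕ, A * Real.exp (5 * r₁ + 1) * K₀ (4 * 2 ^ (F.P K).d) (2 * (F.P K).d) * (2 * ((F.P K).d : ℝ) + 1) * (4 * 2 ^ (F.P K).d) ≤ 1 :=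
    fun K => by
    rw [F.P_d K, e64, e9]
    calc A * Real.exp (5 * r₁ + 1) * K₀ 64 (2 * 4) * 9 * 64 = A * Real.exp (5 * r₁ + 1) * K₀ 64 8 * 9 * 64 := by norm_num
      _ ≤ 1 := hsmall
  have main := fun K => genAnalyticReading_of_activityReading (Gn K) (sp K) (Adm K) (ρA K) (h K) hA hr₁ (hrate' K) (hsmall' K) (hHA K) (hHh K) (hH38 K)
  refine ⟨fun K k t φ X p => locE (tgeometry (F.P K).d (domCount (F.P K) M (k + 1))).ι (tgeometry (F.P K).d (domCount (F.P K) M (k + 1))).cubes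
      (fun Z => h K k t φ Z p) ((tgeometry (F.P K).d (domCount (F.P K) M (k + 1))).cubes X),
    fun K => (main K).1, fun K => (main K).2.1, fun K k t ht X φ hφ p hp => ?_⟩
  have hb := (main K).2.2 k t ht X φ hφ p hp
  have eM : Real.exp 1 * (2 * ((F.P K).d : ℝ) + 1) * (4 * 2 ^ (F.P K).d) * K₀ (4 * 2 ^ (F.P K).d) (2 * (F.P K).d) ^ 2 * A =
      Real.exp 1 * 9 * 64 * K₀ 64 8 ^ 2 * A := by
    rw [F.P_d K, e64, e9]
  rw [eM] at hb
  exact hb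

end Family

end YMDAG.N10

end
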